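import Literature.MathematicalPhysics.QuantumFieldTheory.Balaban1983to89.B9Thm314WholeExpansionReads

/-!
# `Balaban1983to89.B9Thm314WholeCancellation` — [B9] Theorem 3.14 (pp. 426–427): THE DOMINATION READING OF ROWS 22–23
# (`B9Thm314WholeSummation.DominatedBySums`) PROVED AT NODE 00's BOND-SECTOR READING `Node00.kernelFamilyB` FROM A LOCATED APPROXIMATION
# IDENTITY «the partial sums over the walk sets approximate the letter on the read sets»

T. Bałaban, *Propagators for lattice gauge theories in a background field*, Commun. Math. Phys. **99** (1985) 389–434
[`Balaban1985BackgroundPropagators`, "B9"].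

statement-level skeleton of published theorems with citation tags; proofs where landed; nothing here is a claim about the Yang–Mills mass gap

THE PRINTED LOCI (verbatim).  p. 427 (proof of Theorem 3.14): *"We take random walk expansions for both operators. Terms of these expansions
are the same for walks which have all localizations contained in Ω, or Ω^{(k)}, thus in the difference they are cancelled and we have walks
with at least one localization intersecting Ωᶜ. … This remark, the estimates (3.108) and the corresponding estimates for other norms, give
the inequalities of the above theorem."*; p. 416: *"… the expansion (3.107) is convergent in all norms in the inequalities (3.42)–(3.47)."*

THE POINT.  In the N06 certificate at def-Y's instance (n06-d g3) rows 22–23 carry the binder `hdom : … → DominatedBySums (pairExpansion …)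
(pairTermK …) ((opsYOfLetters …) x).Kdiff (W x) U` — the structural reading «each of the thirteen (3.42)–(3.46) quantities of the difference family is
below every uniform bound of the partial sums of the same quantity of the walk terms» (n06-m g2, `B9Thm314WholeSummation`), where `Kdiff` IS def-Y's
reading `kernelFamilyB … 𝔏.Kdiff 𝔏.parB` of the LETTER G(Ω, U) − G(Ω′, U).  THIS FILE PROVES that reading at `kernelFamilyB` for ANY letter `O`,
walk-term letters `T ω` and walk sets `W`, from the located hypothesis `B9Thm314WholeExpansionReads.ExpansionReads i cfg O T W U` (the partial sums
`Σ_{k<m} Σ_{ω ∈ W k y y′} (T ω)(U)Ψ` approximate `O(U)Ψ` on the read sets of the functionals at y, for the three probe inputs Ψ) — what print's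
norm-convergent identity «G(Ω) − G(Ω′) = Σ_{ω touching Ωᶜ} ±(ω-terms)» says on a finite lattice (the sign is absorbed in `T₂`: the functionals are
even).  Contents: the read sets of the thirteen atoms (private), the thirteen entries one lemma each (the quantities of `kernelFamilyB` unfolded
by `change`∕`show`, definitionally; per atom `atom_le` + boundedness over the ball), the five clauses, and ★★ `dominatedBySums_kernelFamilyB` —
`ExpansionReads i cfg O T W U → DominatedBySums E (fun ω => kernelFamilyB i B cfg (T ω) par) (kernelFamilyB i B cfg O par) W U` (𝔸 finite-dimensional,
as the record's `Matrix (Fin N) (Fin N) ℂ`).  The pair ∕ layer faces are the sibling `B9Thm314WholeCancellationLayer`.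

HONEST SCOPE.  The reading is DISCHARGED into generic functional analysis; what stays displayed is the located approximation identity
`ExpansionReads` for the letter `𝔏.Kdiff` and walk-term letters `T₁ T₂` (the cancellation identity of p. 427 — GAPS G-B9-08 — in operator form),
plus everything else of rows 22–23 as before (two Theorem-3.10 letters, now about the readings of `T₁ T₂`; geometry; `hr` — flag T314 (ii) STANDS;
walk sets per sequence).  Nothing of print asserted; no expansion constructed; NOT a node discharge, NOT summit progress; one finite lattice
paper; nothing continuum, nothing about the mass gap.  Cell `pub-ymgap` (D-0062), node N06 [B9], N06-ASSIGNMENT v1 rows 22–23 (successor file of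
bundle F8), seat `pub-ymgap-dag-n06-m` (g3), 2026-08-27.
-/

noncomputable section

namespace Literature.MathematicalPhysics.QuantumFieldTheory.Balaban1983to89.B9Thm314WholeCancellation

open Finset
open B6GlobalChartV1 (PV blkV1)
open B6KLevelCensusIndexV1 (KIdx)
open B6Ineq2142KLevelV1 (β)
open B9GeoNormsKLevelV1 (geo9K)
open Node00 (FBondY BlkY CfgY BallY BondOpY BondParY liftY cdB cdsB lapB supInB l2OfY holderQB kernelFamilyB)
open B9Thm314WholeReadingCalculus B9Thm314WholeReadingLattice B9Thm314WholeExpansionReads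
open B9Thm314WholeSummation (DominatedBySums)

variable {d ℓ : ℕ} {hd : 1 ≤ d + 1} {hL : Odd (ℓ + 1) ∧ 1 < ℓ + 1} {b₀ b₁ : ℝ} {𝔸 : Type} [NormedRing 𝔸] [NormedAlgebra ℂ 𝔸] [CompleteSpace 𝔸]

/-! ## §3 The domination reading PROVED at `kernelFamilyB` -/

section Main

variable {i : KIdx d ℓ hd hL b₀ b₁} {B : B9.Backgrounds} {E : B9.RWExpansion (geo9K i) B}
variable {cfg : B.Cfg → CfgY 𝔸 i} {O : BondOpY 𝔸 i} {T : E.Walk → BondOpY 𝔸 i}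
  {W : ℕ → (geo9K i).Site → (geo9K i).Site → Finset E.Walk} {U : B.Cfg} (par : BondParY 𝔸 i)

omit [NormedAlgebra ℂ 𝔸] [CompleteSpace 𝔸] in
/-- the block sup reads the two-step neighbourhood of the block (a fortiori). [cite: Balaban1985BackgroundPropagators, (3.42) p.397 («x ∈ Δ(y)»), bookkeeping] -/
private theorem reads_blk0 (y : (geo9K i).Site) :
    IsReadingFn (supInB i (β i.hN i.D i.hk y) : (FBondY i → 𝔸) → ℝ) (nb1 i (nb1 i {x | blkV1 i.hN i.D x = β i.hN i.D i.hk y})) :=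
  (isReadingFn_supInB _).mono ((subset_nb1 _).trans (subset_nb1 _))

/-- the block sup of ∇_νΦ reads the two-step neighbourhood of the block. [cite: Balaban1985BackgroundPropagators, (3.42) p.397, bookkeeping] -/
private theorem reads_blk1 (y : (geo9K i).Site) (Uc : CfgY 𝔸 i) (ν : Fin (d + 1)) :
    IsReadingFn (fun Φ : FBondY i → 𝔸 => supInB i (β i.hN i.D i.hk y) (cdB i Uc ν Φ))
      (nb1 i (nb1 i {x | blkV1 i.hN i.D x = β i.hN i.D i.hk y})) :=
  ((isReadingFn_supInB _).comp (isLocalOp_cdB Uc ν _)).mono (subset_nb1 _)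

/-- the block sup of Δ_UΦ reads the two-step neighbourhood of the block. [cite: Balaban1985BackgroundPropagators, (3.42) p.397, bookkeeping] -/
private theorem reads_blk3 (y : (geo9K i).Site) (Uc : CfgY 𝔸 i) :
    IsReadingFn (fun Φ : FBondY i → 𝔸 => supInB i (β i.hN i.D i.hk y) (lapB i Uc Φ))
      (nb1 i (nb1 i {x | blkV1 i.hN i.D x = β i.hN i.D i.hk y})) :=
  (isReadingFn_supInB _).comp (isLocalOp_lapB Uc _)

/-- the Hölder quotient reads the one-step neighbourhood of supp ζ (a fortiori). [cite: Balaban1985BackgroundPropagators, (3.43) p.398, bookkeeping] -/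
private theorem reads_holder0 (Uc : CfgY 𝔸 i) (α : ℝ) (z : FBondY i → ℝ) :
    IsReadingFn (holderQB i (par Uc) α z : (FBondY i → 𝔸) → ℝ) (nb1 i {x | z x ≠ 0}) :=
  (isReadingFn_holderQB _ _ _).mono (subset_nb1 _)

/-- the Hölder quotient of ∇_νΦ reads the one-step neighbourhood of supp ζ. [cite: Balaban1985BackgroundPropagators, (3.43) p.398, bookkeeping] -/
private theorem reads_holder1 (Uc : CfgY 𝔸 i) (α : ℝ) (z : FBondY i → ℝ) (ν : Fin (d + 1)) :
    IsReadingFn (fun Φ : FBondY i → 𝔸 => holderQB i (par Uc) α z (cdB i Uc ν Φ)) (nb1 i {x | z x ≠ 0}) :=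
  (isReadingFn_holderQB _ _ _).comp (isLocalOp_cdB Uc ν _)

omit [NormedAlgebra ℂ 𝔸] [CompleteSpace 𝔸] in
/-- the cut-off L² norm reads the two-step neighbourhood of supp h (a fortiori). [cite: Balaban1985BackgroundPropagators, (3.46) p.398, bookkeeping] -/
private theorem reads_l2_0 (h : FBondY i → ℝ) :
    IsReadingFn (l2OfY h : (FBondY i → 𝔸) → ℝ) (nb1 i (nb1 i {x | h x ≠ 0})) :=
  (isReadingFn_l2OfY _).mono ((subset_nb1 _).trans (subset_nb1 _))

/-- the cut-off L² norm of ∇_νΦ reads the two-step neighbourhood of supp h. [cite: Balaban1985BackgroundPropagators, (3.46) p.398, bookkeeping] -/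
private theorem reads_l2_1 (Uc : CfgY 𝔸 i) (h : FBondY i → ℝ) (ν : Fin (d + 1)) :
    IsReadingFn (fun Φ : FBondY i → 𝔸 => l2OfY h (cdB i Uc ν Φ)) (nb1 i (nb1 i {x | h x ≠ 0})) :=
  ((isReadingFn_l2OfY _).comp (isLocalOp_cdB Uc ν _)).mono (subset_nb1 _)

/-- the cut-off L² norm of ∇_ν∇_μΦ reads the two-step neighbourhood of supp h. [cite: Balaban1985BackgroundPropagators, (3.46) p.398, bookkeeping] -/
private theorem reads_l2_2 (Uc : CfgY 𝔸 i) (h : FBondY i → ℝ) (ν μ : Fin (d + 1)) :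
    IsReadingFn (fun Φ : FBondY i → 𝔸 => l2OfY h (cdB i Uc ν (cdB i Uc μ Φ))) (nb1 i (nb1 i {x | h x ≠ 0})) :=
  (isReadingFn_l2OfY _).comp ((isLocalOp_cdB Uc ν _).comp (isLocalOp_cdB Uc μ _))

variable [FiniteDimensional ℂ 𝔸]

/-! ### §3.1 The thirteen entries, one lemma each (explicit forms by `change`∕`show`, definitional) -/

/-- (3.42) entry 0: ‖GJ‖ on the block. [cite: Balaban1985BackgroundPropagators, (3.42) p.397] -/
private theorem e0_le (hR : ExpansionReads i cfg O T W U) (J : FBondY i → ℝ) (y y' : (geo9K i).Site)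
    (hs : (geo9K i).suppIn (Sum.inr J) y') {b : ℝ} (hb0 : 0 ≤ b)
    (hb : ∀ m, ∑ k ∈ Finset.range m, ∑ ω ∈ W k y y', (kernelFamilyB i B cfg (T ω) par).e 0 U (Sum.inr J) y ≤ b) :
    (kernelFamilyB i B cfg O par).e 0 U (Sum.inr J) y ≤ b := by
  have hF0 := reads_blk0 (𝔸 := 𝔸) (i := i) y
  change ∀ m, ∑ k ∈ Finset.range m, ∑ ω ∈ W k y y',
    (⨆ e : BallY 𝔸, supInB i (β i.hN i.D i.hk y) (T ω (cfg U) (liftY J (e : 𝔸)))) ≤ b at hb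
  show (⨆ e : BallY 𝔸, supInB i (β i.hN i.D i.hk y) (O (cfg U) (liftY J (e : 𝔸)))) ≤ b
  exact Real.iSup_le (fun e => atom_le hF0 W T (cfg U) y y' (liftY J (e : 𝔸))
    (fun ω => le_iSup_ball (bound_atom hF0 (T ω (cfg U)) (bound_probe₀ J)) e) hb
    (hR.sup y y' J hs e _ (liftY_mem_probes _ _ _))) hb0

/-- (3.42) entry 1: ‖∇_UGJ‖ on the block. [cite: Balaban1985BackgroundPropagators, (3.42) p.397] -/
private theorem e1_le (hR : ExpansionReads i cfg O T W U) (J : FBondY i → ℝ) (y y' : (geo9K i).Site)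
    (hs : (geo9K i).suppIn (Sum.inr J) y') {b : ℝ} (hb0 : 0 ≤ b)
    (hb : ∀ m, ∑ k ∈ Finset.range m, ∑ ω ∈ W k y y', (kernelFamilyB i B cfg (T ω) par).e 1 U (Sum.inr J) y ≤ b) :
    (kernelFamilyB i B cfg O par).e 1 U (Sum.inr J) y ≤ b := by
  have hF1 := fun ν => reads_blk1 (i := i) y (cfg U) ν
  change ∀ m, ∑ k ∈ Finset.range m, ∑ ω ∈ W k y y', (⨆ e : BallY 𝔸, ⨆ ν : Fin (d + 1),
    supInB i (β i.hN i.D i.hk y) (cdB i (cfg U) ν (T ω (cfg U) (liftY J (e : 𝔸))))) ≤ b at hb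
  show (⨆ e : BallY 𝔸, ⨆ ν : Fin (d + 1), supInB i (β i.hN i.D i.hk y) (cdB i (cfg U) ν (O (cfg U) (liftY J (e : 𝔸))))) ≤ b
  exact Real.iSup_le (fun e => ciSup_le fun ν => atom_le (hF1 ν) W T (cfg U) y y' (liftY J (e : 𝔸))
    (fun ω => le_iSup_ball_iSup (A := fun (e' : BallY 𝔸) (ν' : Fin (d + 1)) => supInB i (β i.hN i.D i.hk y)
      (cdB i (cfg U) ν' (T ω (cfg U) (liftY J (e' : 𝔸)))))
      (fun ν' => bound_atom (hF1 ν') (T ω (cfg U)) (bound_probe₀ J)) e ν) hb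
    (hR.sup y y' J hs e _ (liftY_mem_probes _ _ _))) hb0

/-- (3.42) entry 2: ‖G∇*_UJ‖ on the block. [cite: Balaban1985BackgroundPropagators, (3.42) p.397] -/
private theorem e2_le (hR : ExpansionReads i cfg O T W U) (J : FBondY i → ℝ) (y y' : (geo9K i).Site)
    (hs : (geo9K i).suppIn (Sum.inr J) y') {b : ℝ} (hb0 : 0 ≤ b)
    (hb : ∀ m, ∑ k ∈ Finset.range m, ∑ ω ∈ W k y y', (kernelFamilyB i B cfg (T ω) par).e 2 U (Sum.inr J) y ≤ b) :
    (kernelFamilyB i B cfg O par).e 2 U (Sum.inr J) y ≤ b := by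
  have hF0 := reads_blk0 (𝔸 := 𝔸) (i := i) y
  change ∀ m, ∑ k ∈ Finset.range m, ∑ ω ∈ W k y y', (⨆ e : BallY 𝔸, ⨆ ν : Fin (d + 1),
    supInB i (β i.hN i.D i.hk y) (T ω (cfg U) (cdsB i (cfg U) ν (liftY J (e : 𝔸))))) ≤ b at hb
  show (⨆ e : BallY 𝔸, ⨆ ν : Fin (d + 1), supInB i (β i.hN i.D i.hk y) (O (cfg U) (cdsB i (cfg U) ν (liftY J (e : 𝔸))))) ≤ b
  exact Real.iSup_le (fun e => ciSup_le fun ν => atom_le hF0 W T (cfg U) y y' (cdsB i (cfg U) ν (liftY J (e : 𝔸)))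
    (fun ω => le_iSup_ball_iSup (A := fun (e' : BallY 𝔸) (ν' : Fin (d + 1)) => supInB i (β i.hN i.D i.hk y)
      (T ω (cfg U) (cdsB i (cfg U) ν' (liftY J (e' : 𝔸)))))
      (fun ν' => bound_atom hF0 (T ω (cfg U)) (bound_probe₁ (cfg U) J ν')) e ν) hb
    (hR.sup y y' J hs e _ (cdsB_mem_probes _ _ _ _))) hb0

/-- (3.42) entry 3: ‖Δ_UGJ‖ on the block. [cite: Balaban1985BackgroundPropagators, (3.42) p.397] -/
private theorem e3_le (hR : ExpansionReads i cfg O T W U) (J : FBondY i → ℝ) (y y' : (geo9K i).Site)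
    (hs : (geo9K i).suppIn (Sum.inr J) y') {b : ℝ} (hb0 : 0 ≤ b)
    (hb : ∀ m, ∑ k ∈ Finset.range m, ∑ ω ∈ W k y y', (kernelFamilyB i B cfg (T ω) par).e 3 U (Sum.inr J) y ≤ b) :
    (kernelFamilyB i B cfg O par).e 3 U (Sum.inr J) y ≤ b := by
  have hF3 := reads_blk3 (i := i) y (cfg U)
  change ∀ m, ∑ k ∈ Finset.range m, ∑ ω ∈ W k y y',
    (⨆ e : BallY 𝔸, supInB i (β i.hN i.D i.hk y) (lapB i (cfg U) (T ω (cfg U) (liftY J (e : 𝔸))))) ≤ b at hb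
  show (⨆ e : BallY 𝔸, supInB i (β i.hN i.D i.hk y) (lapB i (cfg U) (O (cfg U) (liftY J (e : 𝔸))))) ≤ b
  exact Real.iSup_le (fun e => atom_le hF3 W T (cfg U) y y' (liftY J (e : 𝔸))
    (fun ω => le_iSup_ball (bound_atom hF3 (T ω (cfg U)) (bound_probe₀ J)) e) hb
    (hR.sup y y' J hs e _ (liftY_mem_probes _ _ _))) hb0

/-- (3.44): ‖∇_UG∇*_UJ‖ on the block. [cite: Balaban1985BackgroundPropagators, (3.44) p.398] -/
private theorem e4_le (hR : ExpansionReads i cfg O T W U) (J : FBondY i → ℝ) (y y' : (geo9K i).Site)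
    (hs : (geo9K i).suppIn (Sum.inr J) y') {b : ℝ} (hb0 : 0 ≤ b)
    (hb : ∀ m, ∑ k ∈ Finset.range m, ∑ ω ∈ W k y y', (kernelFamilyB i B cfg (T ω) par).e4 U (Sum.inr J) y ≤ b) :
    (kernelFamilyB i B cfg O par).e4 U (Sum.inr J) y ≤ b := by
  have hF1 := fun ν => reads_blk1 (i := i) y (cfg U) ν
  change ∀ m, ∑ k ∈ Finset.range m, ∑ ω ∈ W k y y', (⨆ e : BallY 𝔸, ⨆ ν : Fin (d + 1), ⨆ μ : Fin (d + 1),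
    supInB i (β i.hN i.D i.hk y) (cdB i (cfg U) ν (T ω (cfg U) (cdsB i (cfg U) μ (liftY J (e : 𝔸)))))) ≤ b at hb
  show (⨆ e : BallY 𝔸, ⨆ ν : Fin (d + 1), ⨆ μ : Fin (d + 1),
    supInB i (β i.hN i.D i.hk y) (cdB i (cfg U) ν (O (cfg U) (cdsB i (cfg U) μ (liftY J (e : 𝔸)))))) ≤ b
  exact Real.iSup_le (fun e => ciSup_le fun ν => ciSup_le fun μ =>
    atom_le (hF1 ν) W T (cfg U) y y' (cdsB i (cfg U) μ (liftY J (e : 𝔸)))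
    (fun ω => le_iSup_ball_iSup₂ (A := fun (e' : BallY 𝔸) (ν' μ' : Fin (d + 1)) => supInB i (β i.hN i.D i.hk y) (cdB i (cfg U) ν' (T ω (cfg U)
      (cdsB i (cfg U) μ' (liftY J (e' : 𝔸))))))
      (fun ν' μ' => bound_atom (hF1 ν') (T ω (cfg U)) (bound_probe₁ (cfg U) J μ')) e ν μ) hb
    (hR.sup y y' J hs e _ (cdsB_mem_probes _ _ _ _))) hb0

/-- (3.43): the Hölder quotients of ∇_UGJ and G∇*_UJ at the cut-off ζ. [cite: Balaban1985BackgroundPropagators, (3.43) p.398] -/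
private theorem h1_le (hR : ExpansionReads i cfg O T W U) (J : FBondY i → ℝ) (α : ℝ) (z : FBondY i → ℝ) (y y' : (geo9K i).Site)
    (hc : (geo9K i).cutIn (Sum.inr z) y) (hs : (geo9K i).suppIn (Sum.inr J) y') {b : ℝ} (hb0 : 0 ≤ b)
    (hb : ∀ m, ∑ k ∈ Finset.range m, ∑ ω ∈ W k y y', (kernelFamilyB i B cfg (T ω) par).h1 U (Sum.inr J) α (Sum.inr z) ≤ b) :
    (kernelFamilyB i B cfg O par).h1 U (Sum.inr J) α (Sum.inr z) ≤ b := by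
  have hF0 := reads_holder0 (i := i) par (cfg U) α z
  have hF1 := fun ν => reads_holder1 (i := i) par (cfg U) α z ν
  change ∀ m, ∑ k ∈ Finset.range m, ∑ ω ∈ W k y y', (⨆ e : BallY 𝔸,
    max (⨆ ν : Fin (d + 1), holderQB i (par (cfg U)) α z (cdB i (cfg U) ν (T ω (cfg U) (liftY J (e : 𝔸)))))
      (⨆ ν : Fin (d + 1), holderQB i (par (cfg U)) α z (T ω (cfg U) (cdsB i (cfg U) ν (liftY J (e : 𝔸)))))) ≤ b at hb
  show (⨆ e : BallY 𝔸,
    max (⨆ ν : Fin (d + 1), holderQB i (par (cfg U)) α z (cdB i (cfg U) ν (O (cfg U) (liftY J (e : 𝔸)))))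
      (⨆ ν : Fin (d + 1), holderQB i (par (cfg U)) α z (O (cfg U) (cdsB i (cfg U) ν (liftY J (e : 𝔸)))))) ≤ b
  have hbd : ∀ ω : E.Walk,
      (∀ ν', ∃ C : ℝ, ∀ e' : BallY 𝔸, holderQB i (par (cfg U)) α z (cdB i (cfg U) ν' (T ω (cfg U) (liftY J (e' : 𝔸)))) ≤ C) ∧
      ∀ ν', ∃ C : ℝ, ∀ e' : BallY 𝔸, holderQB i (par (cfg U)) α z (T ω (cfg U) (cdsB i (cfg U) ν' (liftY J (e' : 𝔸)))) ≤ C :=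
    fun ω => ⟨fun ν' => bound_atom (hF1 ν') (T ω (cfg U)) (bound_probe₀ J),
      fun ν' => bound_atom hF0 (T ω (cfg U)) (bound_probe₁ (cfg U) J ν')⟩
  refine Real.iSup_le (fun e => max_le (ciSup_le fun ν => ?_) (ciSup_le fun ν => ?_)) hb0
  · exact atom_le (hF1 ν) W T (cfg U) y y' (liftY J (e : 𝔸))
      (fun ω => (le_iSup_ball_max (hbd ω).1 (hbd ω).2 e ν).1) hb (hR.holder y y' J hs z hc e _ (liftY_mem_probes _ _ _))
  · exact atom_le hF0 W T (cfg U) y y' (cdsB i (cfg U) ν (liftY J (e : 𝔸)))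
      (fun ω => (le_iSup_ball_max (hbd ω).1 (hbd ω).2 e ν).2) hb (hR.holder y y' J hs z hc e _ (cdsB_mem_probes _ _ _ _))

/-- (3.45): the Hölder quotient of ∇_UG∇*_UJ at the cut-off ζ. [cite: Balaban1985BackgroundPropagators, (3.45) p.398] -/
private theorem h2_le (hR : ExpansionReads i cfg O T W U) (J : FBondY i → ℝ) (α : ℝ) (z : FBondY i → ℝ) (y y' : (geo9K i).Site)
    (hc : (geo9K i).cutIn (Sum.inr z) y) (hs : (geo9K i).suppIn (Sum.inr J) y') {b : ℝ} (hb0 : 0 ≤ b)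
    (hb : ∀ m, ∑ k ∈ Finset.range m, ∑ ω ∈ W k y y', (kernelFamilyB i B cfg (T ω) par).h2 U (Sum.inr J) α (Sum.inr z) ≤ b) :
    (kernelFamilyB i B cfg O par).h2 U (Sum.inr J) α (Sum.inr z) ≤ b := by
  have hF1 := fun ν => reads_holder1 (i := i) par (cfg U) α z ν
  change ∀ m, ∑ k ∈ Finset.range m, ∑ ω ∈ W k y y', (⨆ e : BallY 𝔸, ⨆ ν : Fin (d + 1), ⨆ μ : Fin (d + 1),
    holderQB i (par (cfg U)) α z (cdB i (cfg U) ν (T ω (cfg U) (cdsB i (cfg U) μ (liftY J (e : 𝔸)))))) ≤ b at hb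
  show (⨆ e : BallY 𝔸, ⨆ ν : Fin (d + 1), ⨆ μ : Fin (d + 1),
    holderQB i (par (cfg U)) α z (cdB i (cfg U) ν (O (cfg U) (cdsB i (cfg U) μ (liftY J (e : 𝔸)))))) ≤ b
  exact Real.iSup_le (fun e => ciSup_le fun ν => ciSup_le fun μ =>
    atom_le (hF1 ν) W T (cfg U) y y' (cdsB i (cfg U) μ (liftY J (e : 𝔸)))
    (fun ω => le_iSup_ball_iSup₂ (A := fun (e' : BallY 𝔸) (ν' μ' : Fin (d + 1)) => holderQB i (par (cfg U)) α z (cdB i (cfg U) ν' (T ω (cfg U)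
      (cdsB i (cfg U) μ' (liftY J (e' : 𝔸))))))
      (fun ν' μ' => bound_atom (hF1 ν') (T ω (cfg U)) (bound_probe₁ (cfg U) J μ')) e ν μ) hb
    (hR.holder y y' J hs z hc e _ (cdsB_mem_probes _ _ _ _))) hb0

/-- (3.46) line 0: ‖hGJ‖. [cite: Balaban1985BackgroundPropagators, (3.46) p.398] -/
private theorem l0_le (hR : ExpansionReads i cfg O T W U) (J : FBondY i → ℝ) (h : FBondY i → ℝ) (y y' : (geo9K i).Site)
    (hc : (geo9K i).cutIn (Sum.inr h) y) (hs : (geo9K i).suppIn (Sum.inr J) y') {b : ℝ} (hb0 : 0 ≤ b)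
    (hb : ∀ m, ∑ k ∈ Finset.range m, ∑ ω ∈ W k y y', (kernelFamilyB i B cfg (T ω) par).l2 0 U (Sum.inr J) (Sum.inr h) ≤ b) :
    (kernelFamilyB i B cfg O par).l2 0 U (Sum.inr J) (Sum.inr h) ≤ b := by
  have hF0 := reads_l2_0 (𝔸 := 𝔸) (i := i) h
  change ∀ m, ∑ k ∈ Finset.range m, ∑ ω ∈ W k y y',
    (⨆ e : BallY 𝔸, l2OfY h (T ω (cfg U) (liftY J (e : 𝔸)))) ≤ b at hb
  show (⨆ e : BallY 𝔸, l2OfY h (O (cfg U) (liftY J (e : 𝔸)))) ≤ b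
  exact Real.iSup_le (fun e => atom_le hF0 W T (cfg U) y y' (liftY J (e : 𝔸))
    (fun ω => le_iSup_ball (bound_atom hF0 (T ω (cfg U)) (bound_probe₀ J)) e) hb
    (hR.l2 y y' J hs h hc e _ (liftY_mem_probes _ _ _))) hb0

/-- (3.46) line 1: ‖h∇_UGJ‖. [cite: Balaban1985BackgroundPropagators, (3.46) p.398] -/
private theorem l1_le (hR : ExpansionReads i cfg O T W U) (J : FBondY i → ℝ) (h : FBondY i → ℝ) (y y' : (geo9K i).Site)
    (hc : (geo9K i).cutIn (Sum.inr h) y) (hs : (geo9K i).suppIn (Sum.inr J) y') {b : ℝ} (hb0 : 0 ≤ b)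
    (hb : ∀ m, ∑ k ∈ Finset.range m, ∑ ω ∈ W k y y', (kernelFamilyB i B cfg (T ω) par).l2 1 U (Sum.inr J) (Sum.inr h) ≤ b) :
    (kernelFamilyB i B cfg O par).l2 1 U (Sum.inr J) (Sum.inr h) ≤ b := by
  have hF1 := fun ν => reads_l2_1 (i := i) (cfg U) h ν
  change ∀ m, ∑ k ∈ Finset.range m, ∑ ω ∈ W k y y', (⨆ e : BallY 𝔸, ⨆ ν : Fin (d + 1),
    l2OfY h (cdB i (cfg U) ν (T ω (cfg U) (liftY J (e : 𝔸))))) ≤ b at hb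
  show (⨆ e : BallY 𝔸, ⨆ ν : Fin (d + 1), l2OfY h (cdB i (cfg U) ν (O (cfg U) (liftY J (e : 𝔸))))) ≤ b
  exact Real.iSup_le (fun e => ciSup_le fun ν => atom_le (hF1 ν) W T (cfg U) y y' (liftY J (e : 𝔸))
    (fun ω => le_iSup_ball_iSup (A := fun (e' : BallY 𝔸) (ν' : Fin (d + 1)) => l2OfY h (cdB i (cfg U) ν' (T ω (cfg U) (liftY J (e' : 𝔸)))))
      (fun ν' => bound_atom (hF1 ν') (T ω (cfg U)) (bound_probe₀ J)) e ν) hb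
    (hR.l2 y y' J hs h hc e _ (liftY_mem_probes _ _ _))) hb0

/-- (3.46) line 2: ‖hG∇*_UJ‖. [cite: Balaban1985BackgroundPropagators, (3.46) p.398] -/
private theorem l2_le (hR : ExpansionReads i cfg O T W U) (J : FBondY i → ℝ) (h : FBondY i → ℝ) (y y' : (geo9K i).Site)
    (hc : (geo9K i).cutIn (Sum.inr h) y) (hs : (geo9K i).suppIn (Sum.inr J) y') {b : ℝ} (hb0 : 0 ≤ b)
    (hb : ∀ m, ∑ k ∈ Finset.range m, ∑ ω ∈ W k y y', (kernelFamilyB i B cfg (T ω) par).l2 2 U (Sum.inr J) (Sum.inr h) ≤ b) :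
    (kernelFamilyB i B cfg O par).l2 2 U (Sum.inr J) (Sum.inr h) ≤ b := by
  have hF0 := reads_l2_0 (𝔸 := 𝔸) (i := i) h
  change ∀ m, ∑ k ∈ Finset.range m, ∑ ω ∈ W k y y', (⨆ e : BallY 𝔸, ⨆ ν : Fin (d + 1),
    l2OfY h (T ω (cfg U) (cdsB i (cfg U) ν (liftY J (e : 𝔸))))) ≤ b at hb
  show (⨆ e : BallY 𝔸, ⨆ ν : Fin (d + 1), l2OfY h (O (cfg U) (cdsB i (cfg U) ν (liftY J (e : 𝔸))))) ≤ b
  exact Real.iSup_le (fun e => ciSup_le fun ν => atom_le hF0 W T (cfg U) y y' (cdsB i (cfg U) ν (liftY J (e : 𝔸)))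
    (fun ω => le_iSup_ball_iSup (A := fun (e' : BallY 𝔸) (ν' : Fin (d + 1)) => l2OfY h (T ω (cfg U) (cdsB i (cfg U) ν' (liftY J (e' : 𝔸)))))
      (fun ν' => bound_atom hF0 (T ω (cfg U)) (bound_probe₁ (cfg U) J ν')) e ν) hb
    (hR.l2 y y' J hs h hc e _ (cdsB_mem_probes _ _ _ _))) hb0

/-- (3.46) line 3: ‖h∇_UG∇*_UJ‖. [cite: Balaban1985BackgroundPropagators, (3.46) p.398] -/
private theorem l3_le (hR : ExpansionReads i cfg O T W U) (J : FBondY i → ℝ) (h : FBondY i → ℝ) (y y' : (geo9K i).Site)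
    (hc : (geo9K i).cutIn (Sum.inr h) y) (hs : (geo9K i).suppIn (Sum.inr J) y') {b : ℝ} (hb0 : 0 ≤ b)
    (hb : ∀ m, ∑ k ∈ Finset.range m, ∑ ω ∈ W k y y', (kernelFamilyB i B cfg (T ω) par).l2 3 U (Sum.inr J) (Sum.inr h) ≤ b) :
    (kernelFamilyB i B cfg O par).l2 3 U (Sum.inr J) (Sum.inr h) ≤ b := by
  have hF1 := fun ν => reads_l2_1 (i := i) (cfg U) h ν
  change ∀ m, ∑ k ∈ Finset.range m, ∑ ω ∈ W k y y', (⨆ e : BallY 𝔸, ⨆ ν : Fin (d + 1), ⨆ μ : Fin (d + 1),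
    l2OfY h (cdB i (cfg U) ν (T ω (cfg U) (cdsB i (cfg U) μ (liftY J (e : 𝔸)))))) ≤ b at hb
  show (⨆ e : BallY 𝔸, ⨆ ν : Fin (d + 1), ⨆ μ : Fin (d + 1),
    l2OfY h (cdB i (cfg U) ν (O (cfg U) (cdsB i (cfg U) μ (liftY J (e : 𝔸)))))) ≤ b
  exact Real.iSup_le (fun e => ciSup_le fun ν => ciSup_le fun μ =>
    atom_le (hF1 ν) W T (cfg U) y y' (cdsB i (cfg U) μ (liftY J (e : 𝔸)))
    (fun ω => le_iSup_ball_iSup₂ (A := fun (e' : BallY 𝔸) (ν' μ' : Fin (d + 1)) => l2OfY h (cdB i (cfg U) ν' (T ω (cfg U)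
      (cdsB i (cfg U) μ' (liftY J (e' : 𝔸))))))
      (fun ν' μ' => bound_atom (hF1 ν') (T ω (cfg U)) (bound_probe₁ (cfg U) J μ')) e ν μ) hb
    (hR.l2 y y' J hs h hc e _ (cdsB_mem_probes _ _ _ _))) hb0

/-- (3.46) line 4: ‖h∇_U∇_UGJ‖. [cite: Balaban1985BackgroundPropagators, (3.46) p.398] -/
private theorem l4_le (hR : ExpansionReads i cfg O T W U) (J : FBondY i → ℝ) (h : FBondY i → ℝ) (y y' : (geo9K i).Site)
    (hc : (geo9K i).cutIn (Sum.inr h) y) (hs : (geo9K i).suppIn (Sum.inr J) y') {b : ℝ} (hb0 : 0 ≤ b)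
    (hb : ∀ m, ∑ k ∈ Finset.range m, ∑ ω ∈ W k y y', (kernelFamilyB i B cfg (T ω) par).l2 4 U (Sum.inr J) (Sum.inr h) ≤ b) :
    (kernelFamilyB i B cfg O par).l2 4 U (Sum.inr J) (Sum.inr h) ≤ b := by
  have hF2 := fun ν μ => reads_l2_2 (i := i) (cfg U) h ν μ
  change ∀ m, ∑ k ∈ Finset.range m, ∑ ω ∈ W k y y', (⨆ e : BallY 𝔸, ⨆ ν : Fin (d + 1), ⨆ μ : Fin (d + 1),
    l2OfY h (cdB i (cfg U) ν (cdB i (cfg U) μ (T ω (cfg U) (liftY J (e : 𝔸)))))) ≤ b at hb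
  show (⨆ e : BallY 𝔸, ⨆ ν : Fin (d + 1), ⨆ μ : Fin (d + 1),
    l2OfY h (cdB i (cfg U) ν (cdB i (cfg U) μ (O (cfg U) (liftY J (e : 𝔸)))))) ≤ b
  exact Real.iSup_le (fun e => ciSup_le fun ν => ciSup_le fun μ =>
    atom_le (hF2 ν μ) W T (cfg U) y y' (liftY J (e : 𝔸))
    (fun ω => le_iSup_ball_iSup₂ (A := fun (e' : BallY 𝔸) (ν' μ' : Fin (d + 1)) => l2OfY h (cdB i (cfg U) ν' (cdB i (cfg U) μ' (T ω (cfg U)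
      (liftY J (e' : 𝔸))))))
      (fun ν' μ' => bound_atom (hF2 ν' μ') (T ω (cfg U)) (bound_probe₀ J)) e ν μ) hb
    (hR.l2 y y' J hs h hc e _ (liftY_mem_probes _ _ _))) hb0

/-- (3.46) line 5: ‖hG∇*_U∇*_UJ‖. [cite: Balaban1985BackgroundPropagators, (3.46) p.398] -/
private theorem l5_le (hR : ExpansionReads i cfg O T W U) (J : FBondY i → ℝ) (h : FBondY i → ℝ) (y y' : (geo9K i).Site)
    (hc : (geo9K i).cutIn (Sum.inr h) y) (hs : (geo9K i).suppIn (Sum.inr J) y') {b : ℝ} (hb0 : 0 ≤ b)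
    (hb : ∀ m, ∑ k ∈ Finset.range m, ∑ ω ∈ W k y y', (kernelFamilyB i B cfg (T ω) par).l2 5 U (Sum.inr J) (Sum.inr h) ≤ b) :
    (kernelFamilyB i B cfg O par).l2 5 U (Sum.inr J) (Sum.inr h) ≤ b := by
  have hF0 := reads_l2_0 (𝔸 := 𝔸) (i := i) h
  change ∀ m, ∑ k ∈ Finset.range m, ∑ ω ∈ W k y y', (⨆ e : BallY 𝔸, ⨆ ν : Fin (d + 1), ⨆ μ : Fin (d + 1),
    l2OfY h (T ω (cfg U) (cdsB i (cfg U) ν (cdsB i (cfg U) μ (liftY J (e : 𝔸)))))) ≤ b at hb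
  show (⨆ e : BallY 𝔸, ⨆ ν : Fin (d + 1), ⨆ μ : Fin (d + 1),
    l2OfY h (O (cfg U) (cdsB i (cfg U) ν (cdsB i (cfg U) μ (liftY J (e : 𝔸)))))) ≤ b
  exact Real.iSup_le (fun e => ciSup_le fun ν => ciSup_le fun μ =>
    atom_le hF0 W T (cfg U) y y' (cdsB i (cfg U) ν (cdsB i (cfg U) μ (liftY J (e : 𝔸))))
    (fun ω => le_iSup_ball_iSup₂ (A := fun (e' : BallY 𝔸) (ν' μ' : Fin (d + 1)) => l2OfY h (T ω (cfg U)
      (cdsB i (cfg U) ν' (cdsB i (cfg U) μ' (liftY J (e' : 𝔸))))))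
      (fun ν' μ' => bound_atom hF0 (T ω (cfg U)) (bound_probe₂ (cfg U) J ν' μ')) e ν μ) hb
    (hR.l2 y y' J hs h hc e _ (cdsB_cdsB_mem_probes _ _ _ _ _))) hb0

/-! ### §3.2 The five clauses and the reading -/

/-- the (3.42) clause (four sup entries; site arguments read 0). [cite: Balaban1985BackgroundPropagators, (3.42) p.397] -/
private theorem clause_e (hR : ExpansionReads i cfg O T W U) (n : Fin 4) (lam : (geo9K i).Loc) (y y' : (geo9K i).Site)
    (hs : (geo9K i).suppIn lam y') (b : ℝ)
    (hb : ∀ m, ∑ k ∈ Finset.range m, ∑ ω ∈ W k y y', (kernelFamilyB i B cfg (T ω) par).e n U lam y ≤ b) :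
    (kernelFamilyB i B cfg O par).e n U lam y ≤ b := by
  have hb0 : 0 ≤ b := by simpa using hb 0
  rcases lam with f | J
  · exact hb0
  · fin_cases n
    · exact e0_le par hR J y y' hs hb0 hb
    · exact e1_le par hR J y y' hs hb0 hb
    · exact e2_le par hR J y y' hs hb0 hb
    · exact e3_le par hR J y y' hs hb0 hb

/-- the (3.46) clause (six L² lines; site arguments ∕ site cut-offs read 0). [cite: Balaban1985BackgroundPropagators, (3.46) p.398] -/
private theorem clause_l2 (hR : ExpansionReads i cfg O T W U) (n : Fin 6) (lam : (geo9K i).Loc) (hh : (geo9K i).Cut)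
    (y y' : (geo9K i).Site) (hc : (geo9K i).cutIn hh y) (hs : (geo9K i).suppIn lam y') (b : ℝ)
    (hb : ∀ m, ∑ k ∈ Finset.range m, ∑ ω ∈ W k y y', (kernelFamilyB i B cfg (T ω) par).l2 n U lam hh ≤ b) :
    (kernelFamilyB i B cfg O par).l2 n U lam hh ≤ b := by
  have hb0 : 0 ≤ b := by simpa using hb 0
  rcases lam with f | J
  · cases hh <;> exact hb0
  · rcases hh with z | h
    · exact hb0
    · fin_cases n
      · exact l0_le par hR J h y y' hc hs hb0 hb
      · exact l1_le par hR J h y y' hc hs hb0 hb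
      · exact l2_le par hR J h y y' hc hs hb0 hb
      · exact l3_le par hR J h y y' hc hs hb0 hb
      · exact l4_le par hR J h y y' hc hs hb0 hb
      · exact l5_le par hR J h y y' hc hs hb0 hb

/-- the (3.43) clause. [cite: Balaban1985BackgroundPropagators, (3.43) p.398] -/
private theorem clause_h1 (hR : ExpansionReads i cfg O T W U) (lam : (geo9K i).Loc) (α : ℝ) (ζ : (geo9K i).Cut)
    (y y' : (geo9K i).Site) (hc : (geo9K i).cutIn ζ y) (hs : (geo9K i).suppIn lam y') (b : ℝ)
    (hb : ∀ m, ∑ k ∈ Finset.range m, ∑ ω ∈ W k y y', (kernelFamilyB i B cfg (T ω) par).h1 U lam α ζ ≤ b) :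
    (kernelFamilyB i B cfg O par).h1 U lam α ζ ≤ b := by
  have hb0 : 0 ≤ b := by simpa using hb 0
  rcases lam with f | J
  · cases ζ <;> exact hb0
  · rcases ζ with z | z
    · exact hb0
    · exact h1_le par hR J α z y y' hc hs hb0 hb

/-- the (3.44) clause. [cite: Balaban1985BackgroundPropagators, (3.44) p.398] -/
private theorem clause_e4 (hR : ExpansionReads i cfg O T W U) (lam : (geo9K i).Loc) (y y' : (geo9K i).Site)
    (hs : (geo9K i).suppIn lam y') (b : ℝ)
    (hb : ∀ m, ∑ k ∈ Finset.range m, ∑ ω ∈ W k y y', (kernelFamilyB i B cfg (T ω) par).e4 U lam y ≤ b) :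
    (kernelFamilyB i B cfg O par).e4 U lam y ≤ b := by
  have hb0 : 0 ≤ b := by simpa using hb 0
  rcases lam with f | J
  · exact hb0
  · exact e4_le par hR J y y' hs hb0 hb

/-- the (3.45) clause. [cite: Balaban1985BackgroundPropagators, (3.45) p.398] -/
private theorem clause_h2 (hR : ExpansionReads i cfg O T W U) (lam : (geo9K i).Loc) (α : ℝ) (ζ : (geo9K i).Cut)
    (y y' : (geo9K i).Site) (hc : (geo9K i).cutIn ζ y) (hs : (geo9K i).suppIn lam y') (b : ℝ)
    (hb : ∀ m, ∑ k ∈ Finset.range m, ∑ ω ∈ W k y y', (kernelFamilyB i B cfg (T ω) par).h2 U lam α ζ ≤ b) :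
    (kernelFamilyB i B cfg O par).h2 U lam α ζ ≤ b := by
  have hb0 : 0 ≤ b := by simpa using hb 0
  rcases lam with f | J
  · cases ζ <;> exact hb0
  · rcases ζ with z | z
    · exact hb0
    · exact h2_le par hR J α z y y' hc hs hb0 hb

/-- ★★ **THE DOMINATION READING PROVED AT NODE 00's BOND-SECTOR READING**: if the expansion with walk terms `T ω` and walk sets `W` is read on
the read sets at U (`ExpansionReads`), then the family `kernelFamilyB i B cfg O par` is dominated by the partial sums of the families
`kernelFamilyB i B cfg (T ω) par` over `W` at U — all thirteen (3.42)–(3.46) quantities (`B9Thm314WholeSummation.DominatedBySums`).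
[cite: Balaban1985BackgroundPropagators, Thm 3.14 proof p.427 + Thm 3.10 proof p.416] -/
theorem dominatedBySums_kernelFamilyB (hR : ExpansionReads i cfg O T W U) :
    DominatedBySums E (fun ω => kernelFamilyB i B cfg (T ω) par) (kernelFamilyB i B cfg O par) W U :=
  ⟨fun n lam y y' hs b hb => clause_e par hR n lam y y' hs b hb,
    fun n lam hh y y' hc hs b hb => clause_l2 par hR n lam hh y y' hc hs b hb,
    fun lam α ζ y y' hc hs b hb => clause_h1 par hR lam α ζ y y' hc hs b hb,
    fun lam y y' hs b hb => clause_e4 par hR lam y y' hs b hb,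
    fun lam α ζ y y' hc hs b hb => clause_h2 par hR lam α ζ y y' hc hs b hb⟩

end Main

end Literature.MathematicalPhysics.QuantumFieldTheory.Balaban1983to89.B9Thm314WholeCancellation

end
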